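import Mathlib
import Summits.AnomalousDissipation.AnomalousDissipation.Theorems.DyadicWallCascadeDyadicRealisationLerayCappingTools
import Summits.AnomalousDissipation.AnomalousDissipation.Theorems.DyadicWallCascadeDyadicRealisationLerayCappingTools2
import Summits.AnomalousDissipation.AnomalousDissipation.Theorems.DyadicWallCascadeDyadicRealisationLerayCappingTools4
import HarnessLib

/-!
# Leray capping, tools VIII: mean and work of the residual force

Tools file for `stub_lerayCapping` (crux `DyadicRealisation`, line Sketch).  For a capped pair
`(U, P)` with residual `R₀ = (U·∇)U + ∇P` on the layer (divergence-free `U`, horizontally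
periodic, equal to the hierarchy `(V, Q)` resp. its mirror image next to the wall) the cube
integrals of `R₀` and of `⟪R₀, U⟫` are boundary terms on the two faces `Y₂ = 1/16, 15/16`
(`R₀ⱼ = Σᵢ ∂ᵢ(UᵢUⱼ + δᵢⱼP)`, `⟪R₀, U⟫ = Σᵢ ∂ᵢ(Uᵢ(|U|²/2 + P))`, divergence theorem of tools IV),
which the mirror symmetry turns into `−2 ×` (Reynolds stress resp. energy flux through the unit
square at height `1/16`) `= −2 ×` (the same at height `1`, dyadic invariance of tools II): hence
`∫ R₀ = 0` when the stresses `τ₀, τ₁` vanish, and `∫ ⟪R₀, U⟫ = −2F` (`lerayCapping_integrals`).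
Ends with the registered stub `stub_lerayCappingTools8`.
-/

open Set Function MeasureTheory Filter Topology
open Literature.Analysis.FunctionSpaces
open scoped BigOperators ContDiff InnerProductSpace

set_option linter.dupNamespace false

namespace Summit.AnomalousDissipation.AnomalousDissipation.Theorems

/-- Expansion of a linear map along the standard basis of `ℝ³`: `L v = Σᵢ vᵢ L eᵢ`. [folklore] -/
theorem lerayCapping_clm_apply_eq_sum {F : Type*} [NormedAddCommGroup F] [NormedSpace ℝ F]
    (L : EuclideanSpace ℝ (Fin 3) →L[ℝ] F) (v : EuclideanSpace ℝ (Fin 3)) :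
    L v = ∑ i : Fin 3, v i • L (EuclideanSpace.single i (1 : ℝ)) := by
  conv_lhs => rw [← (EuclideanSpace.basisFun (Fin 3) ℝ).sum_repr v]
  simp [map_sum, map_smul, EuclideanSpace.basisFun_apply]

/-- Coordinates of the gradient: `(∇P)(Y)ⱼ = DP(Y) eⱼ`. [folklore] -/
theorem lerayCapping_gradient_apply (P : EuclideanSpace ℝ (Fin 3) → ℝ) (Y : EuclideanSpace ℝ (Fin 3))
    (j : Fin 3) : (gradient P Y) j = fderiv ℝ P Y (EuclideanSpace.single j (1 : ℝ)) := by
  have h := EuclideanSpace.inner_single_right j (1 : ℝ) (gradient P Y)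
  rw [gradient, InnerProductSpace.toDual_symm_apply] at h
  rw [gradient]
  simpa using h.symm

/-- **Momentum flux, pointwise**: for `U` divergence free at `Y`,
`Σᵢ ∂ᵢ(UᵢUⱼ + δᵢⱼP)(Y) = ((U·∇)U + ∇P)(Y)ⱼ`. [folklore] -/
theorem lerayCapping_momentum_pointwise
    (U : EuclideanSpace ℝ (Fin 3) → EuclideanSpace ℝ (Fin 3)) (P : EuclideanSpace ℝ (Fin 3) → ℝ)
    (Y : EuclideanSpace ℝ (Fin 3)) (hUd : DifferentiableAt ℝ U Y) (hPd : DifferentiableAt ℝ P Y)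
    (hdiv : ∑ i : Fin 3, (fderiv ℝ U Y (EuclideanSpace.single i (1 : ℝ))) i = 0) (j : Fin 3) :
    ∑ i : Fin 3, fderiv ℝ (fun Z : EuclideanSpace ℝ (Fin 3) =>
        (U Z) i * (U Z) j + (if i = j then (1 : ℝ) else 0) * P Z) Y (EuclideanSpace.single i (1 : ℝ)) =
      (fderiv ℝ U Y (U Y) + gradient P Y) j := by
  have hUi : ∀ i, HasFDerivAt (fun Z => (U Z) i) ((EuclideanSpace.proj i).comp (fderiv ℝ U Y)) Y :=
    fun i => (EuclideanSpace.proj (𝕜 := ℝ) i).hasFDerivAt.comp Y hUd.hasFDerivAt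
  have hφ : ∀ i, fderiv ℝ (fun Z : EuclideanSpace ℝ (Fin 3) =>
      (U Z) i * (U Z) j + (if i = j then (1 : ℝ) else 0) * P Z) Y (EuclideanSpace.single i (1 : ℝ)) =
      (U Y) i * (fderiv ℝ U Y (EuclideanSpace.single i (1 : ℝ))) j +
        (U Y) j * (fderiv ℝ U Y (EuclideanSpace.single i (1 : ℝ))) i +
        (if i = j then (1 : ℝ) else 0) * fderiv ℝ P Y (EuclideanSpace.single i (1 : ℝ)) := by
    intro i
    have h := ((hUi i).fun_mul (hUi j)).fun_add (hPd.hasFDerivAt.const_mul (if i = j then (1 : ℝ) else 0))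
    rw [h.fderiv]
    by_cases hij : i = j <;> simp [hij]
  simp_rw [hφ, Finset.sum_add_distrib, ← Finset.mul_sum, hdiv, mul_zero, add_zero]
  rw [PiLp.add_apply, lerayCapping_gradient_apply, lerayCapping_clm_apply_eq_sum (fderiv ℝ U Y) (U Y)]
  simp [Finset.sum_ite_eq', smul_eq_mul]

/-- **Energy flux, pointwise**: for `U` divergence free at `Y`,
`Σᵢ ∂ᵢ(Uᵢ(|U|²/2 + P))(Y) = ⟪((U·∇)U + ∇P)(Y), U(Y)⟫`. [folklore] -/
theorem lerayCapping_energy_pointwise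
    (U : EuclideanSpace ℝ (Fin 3) → EuclideanSpace ℝ (Fin 3)) (P : EuclideanSpace ℝ (Fin 3) → ℝ)
    (Y : EuclideanSpace ℝ (Fin 3)) (hUd : DifferentiableAt ℝ U Y) (hPd : DifferentiableAt ℝ P Y)
    (hdiv : ∑ i : Fin 3, (fderiv ℝ U Y (EuclideanSpace.single i (1 : ℝ))) i = 0) :
    ∑ i : Fin 3, fderiv ℝ (fun Z : EuclideanSpace ℝ (Fin 3) =>
        (U Z) i * (‖U Z‖ ^ 2 / 2 + P Z)) Y (EuclideanSpace.single i (1 : ℝ)) =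
      ⟪fderiv ℝ U Y (U Y) + gradient P Y, U Y⟫_ℝ := by
  have hUi : ∀ i, HasFDerivAt (fun Z => (U Z) i) ((EuclideanSpace.proj i).comp (fderiv ℝ U Y)) Y :=
    fun i => (EuclideanSpace.proj (𝕜 := ℝ) i).hasFDerivAt.comp Y hUd.hasFDerivAt
  have hBeq : (fun Z => ‖U Z‖ ^ 2 / 2 + P Z) = fun Z => (2⁻¹ : ℝ) * ‖U Z‖ ^ 2 + P Z := by
    funext Z; ring
  have hB : HasFDerivAt (fun Z => ‖U Z‖ ^ 2 / 2 + P Z)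
      ((2⁻¹ : ℝ) • ((2 : ℕ) • (innerSL ℝ (U Y)).comp (fderiv ℝ U Y)) + fderiv ℝ P Y) Y := by
    rw [hBeq]
    exact ((hUd.hasFDerivAt.norm_sq).const_mul 2⁻¹).add hPd.hasFDerivAt
  have hψ : ∀ i, fderiv ℝ (fun Z : EuclideanSpace ℝ (Fin 3) => (U Z) i * (‖U Z‖ ^ 2 / 2 + P Z)) Y
      (EuclideanSpace.single i (1 : ℝ)) =
      (U Y) i * (⟪U Y, fderiv ℝ U Y (EuclideanSpace.single i (1 : ℝ))⟫_ℝ +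
        fderiv ℝ P Y (EuclideanSpace.single i (1 : ℝ))) +
        (‖U Y‖ ^ 2 / 2 + P Y) * (fderiv ℝ U Y (EuclideanSpace.single i (1 : ℝ))) i := by
    intro i
    rw [((hUi i).fun_mul hB).fderiv]
    simp [two_smul]
    ring
  simp_rw [hψ, Finset.sum_add_distrib, ← Finset.mul_sum, hdiv, mul_zero, add_zero, mul_add,
    Finset.sum_add_distrib]
  rw [inner_add_left, real_inner_comm (U Y) (fderiv ℝ U Y (U Y)), gradient,
    InnerProductSpace.toDual_symm_apply, lerayCapping_clm_apply_eq_sum (fderiv ℝ U Y) (U Y),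
    lerayCapping_clm_apply_eq_sum (fderiv ℝ P Y) (U Y), inner_sum]
  simp [inner_smul_right, smul_eq_mul]

/-- **Mean and work of the residual force.** See the module docstring. [folklore] -/
theorem lerayCapping_integrals
    (V : EuclideanSpace ℝ (Fin 3) → EuclideanSpace ℝ (Fin 3)) (Q : EuclideanSpace ℝ (Fin 3) → ℝ) (F : ℝ)
    (U : EuclideanSpace ℝ (Fin 3) → EuclideanSpace ℝ (Fin 3)) (P : EuclideanSpace ℝ (Fin 3) → ℝ)
    (R₀ : EuclideanSpace ℝ (Fin 3) → EuclideanSpace ℝ (Fin 3))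
    (hV : ContDiffOn ℝ ((⊤ : ℕ∞) : WithTop ℕ∞) V {X : EuclideanSpace ℝ (Fin 3) | 0 < X 2})
    (hQ : ContDiffOn ℝ ((⊤ : ℕ∞) : WithTop ℕ∞) Q {X : EuclideanSpace ℝ (Fin 3) | 0 < X 2})
    (hdil : ∀ X : EuclideanSpace ℝ (Fin 3), 0 < X 2 → V ((2 : ℝ) • X) = V X ∧ Q ((2 : ℝ) • X) = Q X)
    (hper : ∀ X : EuclideanSpace ℝ (Fin 3), 1 ≤ X 2 → X 2 ≤ 2 →
      V (X + EuclideanSpace.single 0 (1 : ℝ)) = V X ∧ V (X + EuclideanSpace.single 1 (1 : ℝ)) = V X ∧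
      Q (X + EuclideanSpace.single 0 (1 : ℝ)) = Q X ∧ Q (X + EuclideanSpace.single 1 (1 : ℝ)) = Q X)
    (hflux : ∫ q in Icc (0 : ℝ) 1 ×ˢ Icc (0 : ℝ) 1, (V !₂[q.1, q.2, (1 : ℝ)]) 2 *
      (‖V !₂[q.1, q.2, (1 : ℝ)]‖ ^ 2 / 2 + Q !₂[q.1, q.2, (1 : ℝ)]) = F)
    (hτ0 : ∫ q in Icc (0 : ℝ) 1 ×ˢ Icc (0 : ℝ) 1, (V !₂[q.1, q.2, (1 : ℝ)]) 2 * (V !₂[q.1, q.2, (1 : ℝ)]) 0 = 0)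
    (hτ1 : ∫ q in Icc (0 : ℝ) 1 ×ˢ Icc (0 : ℝ) 1, (V !₂[q.1, q.2, (1 : ℝ)]) 2 * (V !₂[q.1, q.2, (1 : ℝ)]) 1 = 0)
    (hU : ContDiffOn ℝ ((⊤ : ℕ∞) : WithTop ℕ∞) U {Y : EuclideanSpace ℝ (Fin 3) | 0 < Y 2 ∧ Y 2 < 1})
    (hP : ContDiffOn ℝ ((⊤ : ℕ∞) : WithTop ℕ∞) P {Y : EuclideanSpace ℝ (Fin 3) | 0 < Y 2 ∧ Y 2 < 1})
    (hperUP : ∀ Y : EuclideanSpace ℝ (Fin 3),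
      U (Y + EuclideanSpace.single 0 (1 : ℝ)) = U Y ∧ U (Y + EuclideanSpace.single 1 (1 : ℝ)) = U Y ∧
      P (Y + EuclideanSpace.single 0 (1 : ℝ)) = P Y ∧ P (Y + EuclideanSpace.single 1 (1 : ℝ)) = P Y)
    (hdivU : ∀ Y : EuclideanSpace ℝ (Fin 3), 0 < Y 2 → Y 2 < 1 →
      ∑ i : Fin 3, (fderiv ℝ U Y (EuclideanSpace.single i (1 : ℝ))) i = 0)
    (hlow : ∀ Y : EuclideanSpace ℝ (Fin 3), 0 < Y 2 → Y 2 < 5 / 64 → U Y = V Y ∧ P Y = Q Y)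
    (hup : ∀ Y : EuclideanSpace ℝ (Fin 3), 59 / 64 < Y 2 → Y 2 < 1 →
      U Y = V (Y + (1 - 2 * Y 2) • EuclideanSpace.single 2 (1 : ℝ)) -
          (2 * (V (Y + (1 - 2 * Y 2) • EuclideanSpace.single 2 (1 : ℝ))) 2) •
            EuclideanSpace.single 2 (1 : ℝ) ∧
        P Y = Q (Y + (1 - 2 * Y 2) • EuclideanSpace.single 2 (1 : ℝ)))
    (hRz : ∀ Y : EuclideanSpace ℝ (Fin 3), (Y 2 < 1 / 16 ∨ 15 / 16 < Y 2) → R₀ Y = 0)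
    (hRf : ∀ Y : EuclideanSpace ℝ (Fin 3), 0 < Y 2 → Y 2 < 1 →
      R₀ Y = fderiv ℝ U Y (U Y) + gradient P Y) :
    (∀ j : Fin 3, ∫ Y in Torus.unitCube (Fin 3), (R₀ Y) j = 0) ∧
    ∫ Y in Torus.unitCube (Fin 3), ⟪R₀ Y, U Y⟫_ℝ = -2 * F := by
  set e2 : EuclideanSpace ℝ (Fin 3) := EuclideanSpace.single 2 (1 : ℝ) with he2
  set S : Set (EuclideanSpace ℝ (Fin 3)) := {Y | 0 < Y 2 ∧ Y 2 < 1} with hS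
  have hc2c : Continuous fun Y : EuclideanSpace ℝ (Fin 3) => Y 2 := PiLp.continuous_apply 2 _ 2
  have hopen : IsOpen {X : EuclideanSpace ℝ (Fin 3) | 0 < X 2} := isOpen_lt continuous_const hc2c
  have hSo : IsOpen S := hopen.inter (isOpen_lt hc2c continuous_const)
  have hUd : ∀ Y ∈ S, DifferentiableAt ℝ U Y := fun Y hY =>
    (hU.differentiableOn (by simp)).differentiableAt (hSo.mem_nhds hY)
  have hPd : ∀ Y ∈ S, DifferentiableAt ℝ P Y := fun Y hY =>
    (hP.differentiableOn (by simp)).differentiableAt (hSo.mem_nhds hY)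
  have hUi : ∀ i, ContDiffOn ℝ ((⊤ : ℕ∞) : WithTop ℕ∞) (fun Y => (U Y) i) S := fun i =>
    (EuclideanSpace.proj (𝕜 := ℝ) i).contDiff.comp_contDiffOn hU
  -- the box and its faces
  have hbox : ∀ x ∈ Icc (![0, 0, 1 / 16] : Fin 3 → ℝ) ![1, 1, 15 / 16],
      (WithLp.toLp 2 x : EuclideanSpace ℝ (Fin 3)) ∈ S := by
    intro x hx
    rw [mem_Icc, Pi.le_def, Pi.le_def] at hx
    have h0 := hx.1 2; have h1 := hx.2 2
    simp at h0 h1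
    refine ⟨?_, ?_⟩ <;> simp <;> linarith
  set W : ℝ × ℝ → EuclideanSpace ℝ (Fin 3) := fun q => V !₂[q.1, q.2, 1 / 16] with hW
  have hZlow : ∀ q : ℝ × ℝ, U !₂[q.1, q.2, 1 / 16] = W q ∧ P !₂[q.1, q.2, 1 / 16] = Q !₂[q.1, q.2, 1 / 16] :=
    fun q => hlow _ (by simp) (by simp; norm_num)
  have hA : ∀ q : ℝ × ℝ, (!₂[q.1, q.2, 15 / 16] : EuclideanSpace ℝ (Fin 3)) +
      (1 - 2 * (!₂[q.1, q.2, 15 / 16] : EuclideanSpace ℝ (Fin 3)) 2) • EuclideanSpace.single 2 (1 : ℝ) =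
      !₂[q.1, q.2, 1 / 16] := by
    intro q; ext i; fin_cases i <;> simp
    norm_num
  have hZup : ∀ q : ℝ × ℝ, U !₂[q.1, q.2, 15 / 16] = W q - (2 * (W q) 2) • e2 ∧
      P !₂[q.1, q.2, 15 / 16] = Q !₂[q.1, q.2, 1 / 16] := by
    intro q
    have h := hup !₂[q.1, q.2, 15 / 16] (by simp; norm_num) (by simp; norm_num)
    rw [hA q] at h
    exact h
  have hup2 : ∀ q : ℝ × ℝ, (W q - (2 * (W q) 2) • e2) 2 = -(W q) 2 := fun q => by
    simp [he2]; ring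
  have hupk : ∀ (q : ℝ × ℝ) (k : Fin 3), k ≠ 2 → (W q - (2 * (W q) 2) • e2) k = (W q) k := fun q k hk => by
    simp [he2, hk]
  -- dyadic transfer of the face integrals at height `1/16` to height `1`
  have hdy : ∀ Φ : EuclideanSpace ℝ (Fin 3) → ℝ, ContinuousOn Φ {X : EuclideanSpace ℝ (Fin 3) | 0 < X 2} →
      (∀ X : EuclideanSpace ℝ (Fin 3), 0 < X 2 → Φ ((2 : ℝ) • X) = Φ X) →
      (∀ X : EuclideanSpace ℝ (Fin 3), 1 ≤ X 2 → X 2 ≤ 2 →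
        Φ (X + EuclideanSpace.single 0 (1 : ℝ)) = Φ X ∧ Φ (X + EuclideanSpace.single 1 (1 : ℝ)) = Φ X) →
      ∫ q in Icc (0 : ℝ) 1 ×ˢ Icc (0 : ℝ) 1, Φ !₂[q.1, q.2, 1 / 16] =
        ∫ q in Icc (0 : ℝ) 1 ×ˢ Icc (0 : ℝ) 1, Φ !₂[q.1, q.2, (1 : ℝ)] := by
    intro Φ h1 h2 h3
    have h := lerayCapping_slice_dyadic Φ h1 h2 h3 4
    rw [show ((2 : ℝ) ^ 4)⁻¹ = 1 / 16 by norm_num] at h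
    exact h
  have hVc : ContinuousOn V {X : EuclideanSpace ℝ (Fin 3) | 0 < X 2} := hV.continuousOn
  have hQc : ContinuousOn Q {X : EuclideanSpace ℝ (Fin 3) | 0 < X 2} := hQ.continuousOn
  have hVkc : ∀ k, ContinuousOn (fun X => (V X) k) {X : EuclideanSpace ℝ (Fin 3) | 0 < X 2} := fun k =>
    (PiLp.continuous_apply 2 (fun _ : Fin 3 => ℝ) k).comp_continuousOn hVc
  refine ⟨fun j => ?_, ?_⟩
  · -- the mean of `R₀ⱼ`
    rw [lerayCapping_setIntegral_unitCube_eq_box (fun Y => (R₀ Y) j) (1 / 16) (15 / 16) (by norm_num)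
      (by norm_num) (fun Y _ _ hY => by simp only [hRz Y hY, PiLp.zero_apply])]
    set φ : Fin 3 → EuclideanSpace ℝ (Fin 3) → ℝ := fun i Z =>
      (U Z) i * (U Z) j + (if i = j then (1 : ℝ) else 0) * P Z with hφ
    have hφeq : ∀ x ∈ Icc (![0, 0, 1 / 16] : Fin 3 → ℝ) ![1, 1, 15 / 16], (R₀ (WithLp.toLp 2 x)) j =
        ∑ i : Fin 3, fderiv ℝ (φ i) (WithLp.toLp 2 x) (EuclideanSpace.single i (1 : ℝ)) := by
      intro x hx
      have hY := hbox x hx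
      rw [hRf _ hY.1 hY.2, ← lerayCapping_momentum_pointwise U P _ (hUd _ hY) (hPd _ hY) (hdivU _ hY.1 hY.2) j]
    rw [setIntegral_congr_fun measurableSet_Icc hφeq]
    have hφ1 : ∀ i, ContDiffOn ℝ 1 (φ i) S := fun i =>
      (((hUi i).mul (hUi j)).add (contDiffOn_const.mul hP)).of_le (mod_cast le_top)
    have hφp0 : ∀ Y, φ 0 (Y + EuclideanSpace.single 0 (1 : ℝ)) = φ 0 Y := fun Y => by
      simp only [hφ, (hperUP Y).1, (hperUP Y).2.2.1]
    have hφp1 : ∀ Y, φ 1 (Y + EuclideanSpace.single 1 (1 : ℝ)) = φ 1 Y := fun Y => by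
      simp only [hφ, (hperUP Y).2.1, (hperUP Y).2.2.2]
    rw [lerayCapping_box_divergence φ (1 / 16) (15 / 16) (by norm_num) (by norm_num) (by norm_num) hφ1
      hφp0 hφp1]
    by_cases hj : j = 2
    · subst hj
      have heq : ∀ q : ℝ × ℝ, φ 2 !₂[q.1, q.2, 15 / 16] = φ 2 !₂[q.1, q.2, 1 / 16] := by
        intro q
        simp only [hφ, (hZup q).1, (hZup q).2, (hZlow q).1, (hZlow q).2, hup2, if_true]
        ring
      simp_rw [heq]
      exact sub_self _
    · have hτ : ∫ q in Icc (0 : ℝ) 1 ×ˢ Icc (0 : ℝ) 1, (W q) 2 * (W q) j = 0 := by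
        have h := hdy (fun X => (V X) 2 * (V X) j) ((hVkc 2).mul (hVkc j))
          (fun X hX => by simp only [(hdil X hX).1])
          (fun X h1 h2 => by simp only [(hper X h1 h2).1, (hper X h1 h2).2.1, and_self])
        simp only [hW]
        rw [h]
        fin_cases j
        · exact hτ0
        · exact hτ1
        · exact absurd rfl hj
      have h1 : ∀ q : ℝ × ℝ, φ 2 !₂[q.1, q.2, 15 / 16] = -((W q) 2 * (W q) j) := by
        intro q
        simp only [hφ, (hZup q).1, hup2, hupk q j hj, if_neg (Ne.symm hj), zero_mul, add_zero]
        ring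
      have h2 : ∀ q : ℝ × ℝ, φ 2 !₂[q.1, q.2, 1 / 16] = (W q) 2 * (W q) j := by
        intro q
        simp only [hφ, (hZlow q).1, if_neg (Ne.symm hj), zero_mul, add_zero]
      simp_rw [h1, h2, integral_neg, hτ]
      norm_num
  · -- the work `∫ ⟪R₀, U⟫`
    rw [lerayCapping_setIntegral_unitCube_eq_box (fun Y => ⟪R₀ Y, U Y⟫_ℝ) (1 / 16) (15 / 16) (by norm_num)
      (by norm_num) (fun Y _ _ hY => by simp only [hRz Y hY, inner_zero_left])]
    set ψ : Fin 3 → EuclideanSpace ℝ (Fin 3) → ℝ := fun i Z => (U Z) i * (‖U Z‖ ^ 2 / 2 + P Z) with hψ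
    have hψeq : ∀ x ∈ Icc (![0, 0, 1 / 16] : Fin 3 → ℝ) ![1, 1, 15 / 16], ⟪R₀ (WithLp.toLp 2 x), U (WithLp.toLp 2 x)⟫_ℝ =
        ∑ i : Fin 3, fderiv ℝ (ψ i) (WithLp.toLp 2 x) (EuclideanSpace.single i (1 : ℝ)) := by
      intro x hx
      have hY := hbox x hx
      rw [hRf _ hY.1 hY.2, ← lerayCapping_energy_pointwise U P _ (hUd _ hY) (hPd _ hY) (hdivU _ hY.1 hY.2)]
    rw [setIntegral_congr_fun measurableSet_Icc hψeq]
    have hψ1 : ∀ i, ContDiffOn ℝ 1 (ψ i) S := fun i =>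
      ((hUi i).mul (((hU.norm_sq ℝ).div_const 2).add hP)).of_le (mod_cast le_top)
    have hψp0 : ∀ Y, ψ 0 (Y + EuclideanSpace.single 0 (1 : ℝ)) = ψ 0 Y := fun Y => by
      simp only [hψ, (hperUP Y).1, (hperUP Y).2.2.1]
    have hψp1 : ∀ Y, ψ 1 (Y + EuclideanSpace.single 1 (1 : ℝ)) = ψ 1 Y := fun Y => by
      simp only [hψ, (hperUP Y).2.1, (hperUP Y).2.2.2]
    rw [lerayCapping_box_divergence ψ (1 / 16) (15 / 16) (by norm_num) (by norm_num) (by norm_num) hψ1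
      hψp0 hψp1]
    obtain ⟨Smap, hSY, -, hSnorm, -⟩ := lerayCapping_reflection
    have hnorm : ∀ q : ℝ × ℝ, ‖W q - (2 * (W q) 2) • e2‖ = ‖W q‖ := fun q => by
      rw [← hSY]; exact hSnorm _
    have hF : ∫ q in Icc (0 : ℝ) 1 ×ˢ Icc (0 : ℝ) 1, (W q) 2 * (‖W q‖ ^ 2 / 2 + Q !₂[q.1, q.2, 1 / 16]) = F := by
      have h := hdy (fun X => (V X) 2 * (‖V X‖ ^ 2 / 2 + Q X))
        ((hVkc 2).mul (((hVc.norm.pow 2).div_const 2).add hQc))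
        (fun X hX => by simp only [(hdil X hX).1, (hdil X hX).2])
        (fun X h1 h2 => by
          simp only [(hper X h1 h2).1, (hper X h1 h2).2.1, (hper X h1 h2).2.2.1, (hper X h1 h2).2.2.2, and_self])
      simp only [hW]
      rw [h]
      exact hflux
    have h1 : ∀ q : ℝ × ℝ, ψ 2 !₂[q.1, q.2, 15 / 16] = -((W q) 2 * (‖W q‖ ^ 2 / 2 + Q !₂[q.1, q.2, 1 / 16])) := by
      intro q
      simp only [hψ, (hZup q).1, (hZup q).2, hup2, hnorm]
      ring
    have h2 : ∀ q : ℝ × ℝ, ψ 2 !₂[q.1, q.2, 1 / 16] = (W q) 2 * (‖W q‖ ^ 2 / 2 + Q !₂[q.1, q.2, 1 / 16]) := by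
      intro q
      simp only [hψ, (hZlow q).1, (hZlow q).2]
    simp_rw [h1, h2, integral_neg, hF]
    ring

/-- Registered tools stub of `stub_lerayCapping` (line Sketch of crux `DyadicRealisation`): the
conjunction of the lemmas of this file. [folklore] -/
theorem stub_lerayCappingTools8 :
    (∀ {F : Type*} [NormedAddCommGroup F] [NormedSpace ℝ F] (L : EuclideanSpace ℝ (Fin 3) →L[ℝ] F) (v : EuclideanSpace ℝ (Fin 3)),
      L v = ∑ i : Fin 3, v i • L (EuclideanSpace.single i (1 : ℝ))) ∧
    (∀ (P : EuclideanSpace ℝ (Fin 3) → ℝ) (Y : EuclideanSpace ℝ (Fin 3)) (j : Fin 3), (gradient P Y) j = fderiv ℝ P Y (EuclideanSpace.single j (1 : ℝ))) ∧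
    (∀ (U : EuclideanSpace ℝ (Fin 3) → EuclideanSpace ℝ (Fin 3)) (P : EuclideanSpace ℝ (Fin 3) → ℝ) (Y : EuclideanSpace ℝ (Fin 3)), DifferentiableAt ℝ U Y → DifferentiableAt ℝ P Y →
      ∑ i : Fin 3, (fderiv ℝ U Y (EuclideanSpace.single i (1 : ℝ))) i = 0 → ∀ j : Fin 3,
      ∑ i : Fin 3, fderiv ℝ (fun Z : EuclideanSpace ℝ (Fin 3) =>
          (U Z) i * (U Z) j + (if i = j then (1 : ℝ) else 0) * P Z) Y (EuclideanSpace.single i (1 : ℝ)) =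
        (fderiv ℝ U Y (U Y) + gradient P Y) j) ∧
    (∀ (U : EuclideanSpace ℝ (Fin 3) → EuclideanSpace ℝ (Fin 3)) (P : EuclideanSpace ℝ (Fin 3) → ℝ) (Y : EuclideanSpace ℝ (Fin 3)), DifferentiableAt ℝ U Y → DifferentiableAt ℝ P Y →
      ∑ i : Fin 3, (fderiv ℝ U Y (EuclideanSpace.single i (1 : ℝ))) i = 0 →
      ∑ i : Fin 3, fderiv ℝ (fun Z : EuclideanSpace ℝ (Fin 3) => (U Z) i * (‖U Z‖ ^ 2 / 2 + P Z)) Y (EuclideanSpace.single i (1 : ℝ)) =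
        ⟪fderiv ℝ U Y (U Y) + gradient P Y, U Y⟫_ℝ) ∧
    (∀ (V : EuclideanSpace ℝ (Fin 3) → EuclideanSpace ℝ (Fin 3)) (Q : EuclideanSpace ℝ (Fin 3) → ℝ) (F : ℝ) (U : EuclideanSpace ℝ (Fin 3) → EuclideanSpace ℝ (Fin 3)) (P : EuclideanSpace ℝ (Fin 3) → ℝ) (R₀ : EuclideanSpace ℝ (Fin 3) → EuclideanSpace ℝ (Fin 3)),
      ContDiffOn ℝ ((⊤ : ℕ∞) : WithTop ℕ∞) V {X : EuclideanSpace ℝ (Fin 3) | 0 < X 2} →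
      ContDiffOn ℝ ((⊤ : ℕ∞) : WithTop ℕ∞) Q {X : EuclideanSpace ℝ (Fin 3) | 0 < X 2} →
      (∀ X : EuclideanSpace ℝ (Fin 3), 0 < X 2 → V ((2 : ℝ) • X) = V X ∧ Q ((2 : ℝ) • X) = Q X) →
      (∀ X : EuclideanSpace ℝ (Fin 3), 1 ≤ X 2 → X 2 ≤ 2 →
        V (X + EuclideanSpace.single 0 (1 : ℝ)) = V X ∧ V (X + EuclideanSpace.single 1 (1 : ℝ)) = V X ∧
        Q (X + EuclideanSpace.single 0 (1 : ℝ)) = Q X ∧ Q (X + EuclideanSpace.single 1 (1 : ℝ)) = Q X) →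
      (∫ q in Set.Icc (0 : ℝ) 1 ×ˢ Set.Icc (0 : ℝ) 1, (V !₂[q.1, q.2, (1 : ℝ)]) 2 *
        (‖V !₂[q.1, q.2, (1 : ℝ)]‖ ^ 2 / 2 + Q !₂[q.1, q.2, (1 : ℝ)]) = F) →
      (∫ q in Set.Icc (0 : ℝ) 1 ×ˢ Set.Icc (0 : ℝ) 1, (V !₂[q.1, q.2, (1 : ℝ)]) 2 * (V !₂[q.1, q.2, (1 : ℝ)]) 0 = 0) →
      (∫ q in Set.Icc (0 : ℝ) 1 ×ˢ Set.Icc (0 : ℝ) 1, (V !₂[q.1, q.2, (1 : ℝ)]) 2 * (V !₂[q.1, q.2, (1 : ℝ)]) 1 = 0) →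
      ContDiffOn ℝ ((⊤ : ℕ∞) : WithTop ℕ∞) U {Y : EuclideanSpace ℝ (Fin 3) | 0 < Y 2 ∧ Y 2 < 1} →
      ContDiffOn ℝ ((⊤ : ℕ∞) : WithTop ℕ∞) P {Y : EuclideanSpace ℝ (Fin 3) | 0 < Y 2 ∧ Y 2 < 1} →
      (∀ Y : EuclideanSpace ℝ (Fin 3),
        U (Y + EuclideanSpace.single 0 (1 : ℝ)) = U Y ∧ U (Y + EuclideanSpace.single 1 (1 : ℝ)) = U Y ∧
        P (Y + EuclideanSpace.single 0 (1 : ℝ)) = P Y ∧ P (Y + EuclideanSpace.single 1 (1 : ℝ)) = P Y) →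
      (∀ Y : EuclideanSpace ℝ (Fin 3), 0 < Y 2 → Y 2 < 1 → ∑ i : Fin 3, (fderiv ℝ U Y (EuclideanSpace.single i (1 : ℝ))) i = 0) →
      (∀ Y : EuclideanSpace ℝ (Fin 3), 0 < Y 2 → Y 2 < 5 / 64 → U Y = V Y ∧ P Y = Q Y) →
      (∀ Y : EuclideanSpace ℝ (Fin 3), 59 / 64 < Y 2 → Y 2 < 1 →
        U Y = V (Y + (1 - 2 * Y 2) • EuclideanSpace.single 2 (1 : ℝ)) -
            (2 * (V (Y + (1 - 2 * Y 2) • EuclideanSpace.single 2 (1 : ℝ))) 2) •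
              EuclideanSpace.single 2 (1 : ℝ) ∧
          P Y = Q (Y + (1 - 2 * Y 2) • EuclideanSpace.single 2 (1 : ℝ))) →
      (∀ Y : EuclideanSpace ℝ (Fin 3), (Y 2 < 1 / 16 ∨ 15 / 16 < Y 2) → R₀ Y = 0) →
      (∀ Y : EuclideanSpace ℝ (Fin 3), 0 < Y 2 → Y 2 < 1 → R₀ Y = fderiv ℝ U Y (U Y) + gradient P Y) →
      (∀ j : Fin 3, ∫ Y in Literature.Analysis.FunctionSpaces.Torus.unitCube (Fin 3), (R₀ Y) j = 0) ∧
      ∫ Y in Literature.Analysis.FunctionSpaces.Torus.unitCube (Fin 3), ⟪R₀ Y, U Y⟫_ℝ = -2 * F) :=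
  ⟨fun L v => lerayCapping_clm_apply_eq_sum L v, lerayCapping_gradient_apply,
    lerayCapping_momentum_pointwise, lerayCapping_energy_pointwise, lerayCapping_integrals⟩

end Summit.AnomalousDissipation.AnomalousDissipation.Theorems
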